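import Summits.Langlands.Langlands.Theorems.SoloInformedRepairD2Cris
import Literature.NumberTheory.PAdicHodge.KummerUnitExponentClass
import Mathlib.Algebra.Polynomial.Derivative
import Mathlib.Algebra.Polynomial.AlgebraMap
import HarnessLib
import HarnessLib.Audit.Tags

/-!
# Repair D2-st, part 1 — the CONSTRUCTED ring `B_st(F) = B_max(F)[X]` with `φ`, `N`, `Γ_F`, and `D_st`

Summit `Langlands`.  Sequel of `Theorems/SoloInformedRepairD2Cris` (`B_max(F) = A_max[1/t]` with `φ`, `Γ_F`
and its `ℚ_p`-structure; `D_cris`; the crystalline clause at unramified `v ∣ ℓ`).  What D2-cris could not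
type was the MONODROMY half of Buzzard–Gee Conj. 3.2.2 at `p`: it needs Fontaine's `B_st = B_cris[log[p̃]]`,
whose Galois structure is the Kummer cocycle of a `p`-power root system `p̃` of `p`.  That cocycle is now
in the tree (typed by another programme, for `𝔾_m`): `BdRPlusTop.kummerExp σ ∈ ℤ_p`,
`σ(p_n) = ζ_{pⁿ}^{a(σ)} p_n` (`PAdicHodge/BdRKummerUnitPeriod`), with its crossed-homomorphism law
`a(στ) = a(σ) + χ(σ)·a(τ)` (`PAdicHodge/KummerUnitExponentClass`, `kummerExp_mul`) for the SAME cyclotomic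
character `GaloisRep.cyclotomicCharacter` that moves `t` (`galBmaxPlus_tBmax`, `PAdicHodge/BmaxPlusLog`).
So Fontaine's polynomial model of `B_st` is a construction, with no pinned datum and no named fact:
* `B_st(F) := B_max(F)[X]`; `φ` = coefficientwise `φ` and `X ↦ p·X` (`frobBst`); `N = -d/dX` (`NBst`,
  `ℚ_p`-linear, a `B_max`-derivation with `N X = -1`); `σ ∈ Γ_F` = coefficientwise `σ` and
  `X ↦ X + a_p(σ)·t` (`galBst`; `a_p = kummerP`, the Kummer cocycle of `p ∈ F`, `logShift σ = a_p(σ)·t`).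
  Laws: `σφ = φσ`, `Nφ = p·φN`, `Nσ = σN` (`galBst_comp_frobBst`, `NBst_frobBst`, `NBst_galBst`) and — the
  content of the cocycle law — `galBst 1 = id`, `galBst (στ) = galBst σ ∘ galBst τ` (`galBst_one`,
  `galBst_mul`; with `galBmax_one`, `galBmax_mul`): `Γ_F` ACTS on `B_st(F)` by ring automorphisms
  commuting with `φ` and `N`.  (Fontaine, Exp. II §3: `B_st = B_cris[u]` with `N`, `φ u = p u`,
  `σ u = u + a(σ) t`; in Berger's exposition (arXiv:math/0210184, Ch. II, "Semi-stable representations"),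
  verbatim: `B_st = B_cris[Y]`, `g(Y) = Y + c(g) t` with `g(p^{1/pⁿ}) = p^{1/pⁿ} (ε^{(n)})^{c(g)}`, "the
  monodromy map `N = -d/dY`", and `φ(t) = p t`, `φ(u) = p u` in the Tate-curve paragraph.  The
  `B_cris`-linear map `Y ↦ log[p̃]` to `B_dR` — which needs a choice of `log_p(p)` — is neither used nor
  claimed, nor is any filtration; `B_max[X]` versus `B_cris[X]` changes nothing below, since only the
  `(φ, N, Γ_F)`-structure is used.)
* `D_st(ρ_v) := (ℚ̄_p^m ⊗_{ℚ_p} B_st(F))^{Γ_F}` for a framed `ρ_v : Γ_F → GL_m(ℚ̄_p)` (`Dst`: the functor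
  `D2Cris.invariants` of part D2-cris applied to `B_st`), with `φ_D` (`phiDst`) and `N_D` (`NDst`, through
  `endD`: a `ℚ_p`-LINEAR endomorphism of the period ring commuting with `Γ` restricts to `D`), and the
  relation `N_D φ_D = p·φ_D N_D` (`NDst_phiDst`).  Neither `K₀ ↪ B_st` nor `B_st^Γ = K₀` nor the finiteness of
  `D_st` is used or claimed.
Part 2 (`Theorems/SoloInformedRepairD2St`) states the semistable Weil–Deligne clause at `v ∣ ℓ` over these
objects; a `GL₂` certificate (the Kummer extension of `1` by `ℚ_p(1)` cut out by `p̃` — Tate's curve with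
`q = p` — has `Sp₂`-structure on `D_st`: `N ≠ 0`) is filed separately.  A Theorems-side shadow for the
operator's decision between the repairs R3⁺ / D2-cris / D2-st / D2-min; the Statement is operator-owned and
unchanged.
-/

noncomputable section

open scoped MatrixGroups Matrix Polynomial TensorProduct
open Field Polynomial
open Literature.NumberTheory.GaloisRepresentations Literature.NumberTheory.PAdicHodge

namespace Summit.Langlands.Langlands.Theorems

namespace D2St

open D2Cris

/-! ### §1 A `ℚ_p`-linear endomorphism of `B` commuting with `Γ`, restricted to `D = (E^m ⊗_{ℚ_p} B)^Γ` -/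

section Abstract

variable {p : ℕ} [Fact p.Prime] {E : Type*} [Field E] [Algebra ℚ_[p] E]
  {Γ : Type*} {B : Type*} [CommRing B] [Algebra ℚ_[p] B] {m : ℕ}

/-- `1 ⊗ f` on `E^m ⊗_{ℚ_p} B` for a `ℚ_p`-linear `f : B → B` (meant: the monodromy `N`, which is a
derivation, not a ring map). [cite: FontaineAsterisque223III, Exp. III §1.3] -/
def endTensor (f : B →ₗ[ℚ_[p]] B) : (Fin m → E) ⊗[ℚ_[p]] B →ₗ[E] (Fin m → E) ⊗[ℚ_[p]] B :=
  TensorProduct.AlgebraTensorModule.map LinearMap.id f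

/-- `1 ⊗ f` commutes with the diagonal action when `f` commutes with `Γ` on `B`. [folklore] -/
theorem diagAct_comp_endTensor (ρ : Γ → GL (Fin m) E) (gal : Γ → (B →ₐ[ℚ_[p]] B))
    (f : B →ₗ[ℚ_[p]] B) (hf : ∀ σ, (gal σ).toLinearMap ∘ₗ f = f ∘ₗ (gal σ).toLinearMap) (σ : Γ) :
    diagAct ρ gal σ ∘ₗ endTensor (E := E) f = endTensor f ∘ₗ diagAct ρ gal σ := by
  refine TensorProduct.AlgebraTensorModule.ext fun v b => ?_
  have h := LinearMap.congr_fun (hf σ) b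
  simp only [LinearMap.comp_apply, AlgHom.toLinearMap_apply] at h
  simp only [LinearMap.comp_apply, endTensor, diagAct, TensorProduct.AlgebraTensorModule.map_tmul,
    LinearMap.id_apply, AlgHom.toLinearMap_apply, h]

/-- **`f_D := (1 ⊗ f)|_{D(ρ)}`** (`E`-linear) for `f` commuting with `Γ`. [cite: FontaineAsterisque223III, Exp. III §1.3] -/
def endD (ρ : Γ → GL (Fin m) E) (gal : Γ → (B →ₐ[ℚ_[p]] B)) (f : B →ₗ[ℚ_[p]] B)
    (hf : ∀ σ, (gal σ).toLinearMap ∘ₗ f = f ∘ₗ (gal σ).toLinearMap) :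
    invariants ρ gal →ₗ[E] invariants ρ gal :=
  (endTensor f).restrict fun x (hx : ∀ σ, diagAct ρ gal σ x = x) (σ : Γ) => by
    have h := LinearMap.congr_fun (diagAct_comp_endTensor ρ gal f hf σ) x
    simp only [LinearMap.comp_apply] at h
    rw [h, hx σ]

end Abstract

/-! ### §2 The constructed ring `B_st(F) = B_max(F)[X]` with `φ`, `N` and `Γ_F` -/

section Bst

variable {F : Type} [Field F] [ValuativeRel F] [TopologicalSpace F] [IsNonarchimedeanLocalField F]
  [CharZero F] {p : ℕ} [Fact p.Prime]

/-- `p ≠ 0` in `F̄`. [folklore] -/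
theorem natCast_normedAlgClosure_ne_zero : algebraMap F (NormedAlgClosure F) (p : F) ≠ 0 :=
  (map_ne_zero_iff _ (algebraMap F (NormedAlgClosure F)).injective).2 (Nat.cast_ne_zero.2 (Fact.out : p.Prime).ne_zero)

variable (p) in
/-- **The Kummer cocycle of `p`**: `a_p(σ) ∈ ℤ_p` with `σ(p_n) = ζ_{pⁿ}^{a_p(σ)} p_n` for the tree's chosen
`p`-power root system `(p_n)_n` of `p ∈ F ⊂ F̄` (`BdRPlusTop.rootSeq`, `BdRPlusTop.kummerExp`).
[cite: FontaineAsterisque223III, Exp. II §1.2.2] [cite: BlochKato1990, Ex. 3.10.1] -/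
def kummerP (σ : absoluteGaloisGroup F) : ℤ_[p] :=
  BdRPlusTop.kummerExp (p := p) σ (natCast_normedAlgClosure_ne_zero (F := F) (p := p))
    (NormedAlgClosure.smul_algebraMap σ (p : F))

/-- Cocycle law `a_p(στ) = a_p(σ) + χ(σ) a_p(τ)` (tree `BdRPlusTop.kummerExp_mul`). [cite: SerreGaloisCohomology1997, II §1.2] -/
theorem kummerP_mul (σ τ : absoluteGaloisGroup F) :
    kummerP p (σ * τ) = kummerP p σ + ((GaloisRep.cyclotomicCharacter F p σ : ℤ_[p]ˣ) : ℤ_[p]) * kummerP p τ :=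
  BdRPlusTop.kummerExp_mul _ _ _ _

/-- `a_p(1) = 0` (tree `BdRPlusTop.kummerExp_one`). [cite: SerreGaloisCohomology1997, II §1.2] -/
theorem kummerP_one : kummerP p (1 : absoluteGaloisGroup F) = 0 :=
  BdRPlusTop.kummerExp_one _ _

variable [Fact (¬ IsUnit (p : integerC F))] [IsAdicComplete (Ideal.span {(p : integerC F)}) (integerC F)]

variable (F p) in
/-- Fontaine's `t` read in `B_max(F) = A_max[1/t]`. [cite: FontaineAsterisque223III, Exp. II §2.3] -/
def tB : Bmax F p := algebraMap (BmaxPlus F p) (Bmax F p) tBmax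

/-- `σ t = χ(σ) t` in `B_max(F)`. [cite: FontaineAsterisque223III, Exp. II §2.3] -/
theorem galBmax_tB (σ : absoluteGaloisGroup F) :
    galBmax σ (tB F p) = zpToBmax F p ((GaloisRep.cyclotomicCharacter F p σ : ℤ_[p]ˣ) : ℤ_[p]) * tB F p := by
  rw [tB, galBmax_algebraMap, galBmaxPlus_tBmax, map_mul]; rfl

/-- `φ t = p t` in `B_max(F)`. [cite: FontaineAsterisque223III, Exp. II §2.3] -/
theorem frobBmax_tB : frobBmax F p (tB F p) = (p : Bmax F p) * tB F p := by
  rw [tB, frobBmax_algebraMap, frobBmaxPlus_tBmax, map_mul, map_natCast, map_natCast]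

/-- `Γ_F` fixes `ℤ_p ⊂ B_max(F)` (pointwise form). [folklore] -/
theorem galBmax_zpToBmax (σ : absoluteGaloisGroup F) (a : ℤ_[p]) : galBmax σ (zpToBmax F p a) = zpToBmax F p a :=
  RingHom.congr_fun (galBmax_comp_zpToBmax σ) a

/-- `φ` fixes `ℤ_p ⊂ B_max(F)` (pointwise form). [folklore] -/
theorem frobBmax_zpToBmax (a : ℤ_[p]) : frobBmax F p (zpToBmax F p a) = zpToBmax F p a :=
  RingHom.congr_fun frobBmax_comp_zpToBmax a

/-- `galBmax 1 = id`. [folklore] -/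
theorem galBmax_one : galBmax (1 : absoluteGaloisGroup F) = RingHom.id (Bmax F p) :=
  IsLocalization.ringHom_ext (Submonoid.powers (tBmax (F := F) (p := p))) <| by
    ext x; simp [galBmax_algebraMap, galBmaxPlus_one]

/-- `galBmax (στ) = galBmax σ ∘ galBmax τ`: `σ ↦ galBmax σ` is an action of `Γ_F` on `B_max(F)`. [folklore] -/
theorem galBmax_mul (σ τ : absoluteGaloisGroup F) : galBmax (σ * τ) = (galBmax σ).comp (galBmax (p := p) τ) :=
  IsLocalization.ringHom_ext (Submonoid.powers (tBmax (F := F) (p := p))) <| by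
    ext x; simp [galBmax_algebraMap, galBmaxPlus_mul]

/-- **The logarithmic shift `a_p(σ)·t ∈ B_max(F)`** — the image of `σ(log[p̃]) - log[p̃]`.
[cite: FontaineAsterisque223III, Exp. II §3] [cite: BergerLaurent2004pAdicReps, Ch. II, Semi-stable representations] -/
def logShift (σ : absoluteGaloisGroup F) : Bmax F p := zpToBmax F p (kummerP p σ) * tB F p

/-- `φ(a_p(σ) t) = p · a_p(σ) t`. [folklore] -/
theorem frobBmax_logShift (σ : absoluteGaloisGroup F) :
    frobBmax F p (logShift σ) = (p : Bmax F p) * logShift σ := by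
  rw [logShift, map_mul, frobBmax_zpToBmax, frobBmax_tB]; ring

/-- Cocycle law of the shift: `a_p(στ) t = a_p(σ) t + σ(a_p(τ) t)`. [cite: SerreGaloisCohomology1997, II §1.2] -/
theorem logShift_mul (σ τ : absoluteGaloisGroup F) :
    logShift (p := p) (σ * τ) = logShift σ + galBmax σ (logShift τ) := by
  rw [logShift, logShift, logShift, kummerP_mul, map_add, map_mul, map_mul (galBmax σ), galBmax_zpToBmax,
    galBmax_tB]; ring

/-- `a_p(1) t = 0`. [folklore] -/
theorem logShift_one : logShift (p := p) (1 : absoluteGaloisGroup F) = 0 := by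
  rw [logShift, kummerP_one, map_zero, zero_mul]

/-- **`σ ∈ Γ_F` on `B_st(F) = B_max(F)[X]`**: coefficientwise `σ` and `X ↦ X + a_p(σ) t` (Fontaine:
`σ(log[p̃]) = log[p̃] + a_p(σ) t`).
[cite: FontaineAsterisque223III, Exp. II §3] [cite: BergerLaurent2004pAdicReps, Ch. II, Semi-stable representations] -/
def galBst (σ : absoluteGaloisGroup F) : (Bmax F p)[X] →+* (Bmax F p)[X] :=
  (compRingHom (X + C (logShift σ))).comp (mapRingHom (galBmax σ))

/-- `σ(P) = (σP)(X + a_p(σ) t)`. [cite: FontaineAsterisque223III, Exp. II §3] -/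
theorem galBst_apply (σ : absoluteGaloisGroup F) (P : (Bmax F p)[X]) :
    galBst σ P = (P.map (galBmax σ)).comp (X + C (logShift σ)) := rfl

/-- `σ` on constants. [cite: FontaineAsterisque223III, Exp. II §3] -/
@[simp] theorem galBst_C (σ : absoluteGaloisGroup F) (b : Bmax F p) : galBst σ (C b) = C (galBmax σ b) := by
  simp [galBst_apply]

/-- `σ X = X + a_p(σ) t`. [cite: FontaineAsterisque223III, Exp. II §3] -/
@[simp] theorem galBst_X (σ : absoluteGaloisGroup F) : galBst (p := p) σ X = X + C (logShift σ) := by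
  simp [galBst_apply]

variable (F p) in
/-- **Frobenius on `B_st(F)`**: coefficientwise `φ` and `X ↦ p X` (`φ(log[p̃]) = p·log[p̃]`).
[cite: FontaineAsterisque223III, Exp. II §3] [cite: BergerLaurent2004pAdicReps, Ch. II, Semi-stable representations] -/
def frobBst : (Bmax F p)[X] →+* (Bmax F p)[X] :=
  (compRingHom (C (p : Bmax F p) * X)).comp (mapRingHom (frobBmax F p))

/-- `φ(P) = (φP)(pX)`. [cite: FontaineAsterisque223III, Exp. II §3] -/
theorem frobBst_apply (P : (Bmax F p)[X]) : frobBst F p P = (P.map (frobBmax F p)).comp (C (p : Bmax F p) * X) := rfl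

/-- `φ` on constants. [cite: FontaineAsterisque223III, Exp. II §3] -/
@[simp] theorem frobBst_C (b : Bmax F p) : frobBst F p (C b) = C (frobBmax F p b) := by simp [frobBst_apply]

/-- `φ X = p X`. [cite: FontaineAsterisque223III, Exp. II §3] -/
@[simp] theorem frobBst_X : frobBst F p X = C (p : Bmax F p) * X := by simp [frobBst_apply]

variable (F p) in
/-- **The monodromy operator `N = -d/dX` on `B_st(F)`** (`ℚ_p`-linear; a `B_max`-derivation with `N X = -1`).
[cite: FontaineAsterisque223III, Exp. II §3] [cite: BergerLaurent2004pAdicReps, Ch. II, Semi-stable representations] -/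
def NBst : (Bmax F p)[X] →ₗ[ℚ_[p]] (Bmax F p)[X] := -((derivative (R := Bmax F p)).restrictScalars ℚ_[p])

/-- `N P = -P'`. [cite: FontaineAsterisque223III, Exp. II §3] -/
@[simp] theorem NBst_apply (P : (Bmax F p)[X]) : NBst F p P = -derivative P := rfl

/-- **`φ` commutes with `Γ_F` on `B_st(F)`.** [cite: FontaineAsterisque223III, Exp. II §3] -/
theorem galBst_comp_frobBst (σ : absoluteGaloisGroup F) :
    (galBst σ).comp (frobBst F p) = (frobBst F p).comp (galBst σ) := by
  refine Polynomial.ringHom_ext (fun b => ?_) ?_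
  · have h := RingHom.congr_fun (galBmax_comp_frobBmax (F := F) (p := p) σ) b
    simp only [RingHom.comp_apply] at h
    simp only [RingHom.comp_apply, frobBst_C, galBst_C, h]
  · simp only [RingHom.comp_apply, frobBst_X, map_mul, map_natCast, galBst_X, map_add, frobBst_C,
      frobBmax_logShift]
    ring

/-- **`N φ = p φ N` on `B_st(F)`.** [cite: FontaineAsterisque223III, Exp. II §3] -/
theorem NBst_frobBst (P : (Bmax F p)[X]) : NBst F p (frobBst F p P) = C (p : Bmax F p) * frobBst F p (NBst F p P) := by
  simp only [NBst_apply, frobBst_apply, derivative_comp, derivative_mul, derivative_C, zero_mul, derivative_X,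
    mul_one, zero_add, derivative_map, Polynomial.map_neg, neg_comp]
  ring

/-- **`N` commutes with `Γ_F` on `B_st(F)`.** [cite: FontaineAsterisque223III, Exp. II §3] -/
theorem NBst_galBst (σ : absoluteGaloisGroup F) (P : (Bmax F p)[X]) : NBst F p (galBst σ P) = galBst σ (NBst F p P) := by
  simp only [NBst_apply, galBst_apply, derivative_comp, derivative_add, derivative_X, derivative_C, add_zero,
    one_mul, derivative_map, Polynomial.map_neg, neg_comp]

/-- **`Γ_F` acts**: `galBst 1 = id`. [folklore] -/
theorem galBst_one : galBst (1 : absoluteGaloisGroup F) = RingHom.id (Bmax F p)[X] := by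
  refine Polynomial.ringHom_ext (fun b => ?_) ?_
  · simp [galBmax_one]
  · simp [logShift_one]

/-- **`Γ_F` acts**: `galBst (στ) = galBst σ ∘ galBst τ` (the cocycle law of `a_p`).
[cite: FontaineAsterisque223III, Exp. II §3] -/
theorem galBst_mul (σ τ : absoluteGaloisGroup F) : galBst (σ * τ) = (galBst σ).comp (galBst (p := p) τ) := by
  refine Polynomial.ringHom_ext (fun b => ?_) ?_
  · simp [galBmax_mul]
  · simp only [galBst_X, RingHom.comp_apply, map_add, logShift_mul]
    rw [galBst_C, add_assoc]

/-- `σ` fixes `ℚ_p ⊂ B_st(F)`. [folklore] -/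
theorem galBst_algebraMap (σ : absoluteGaloisGroup F) (r : ℚ_[p]) :
    galBst σ (algebraMap ℚ_[p] (Bmax F p)[X] r) = algebraMap ℚ_[p] (Bmax F p)[X] r := by
  rw [Polynomial.algebraMap_apply, galBst_C]; exact congrArg C ((galBmaxAlgHom (F := F) (p := p) σ).commutes r)

/-- `φ` fixes `ℚ_p ⊂ B_st(F)`. [folklore] -/
theorem frobBst_algebraMap (r : ℚ_[p]) :
    frobBst F p (algebraMap ℚ_[p] (Bmax F p)[X] r) = algebraMap ℚ_[p] (Bmax F p)[X] r := by
  rw [Polynomial.algebraMap_apply, frobBst_C]; exact congrArg C ((frobBmaxAlgHom F p).commutes r)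

/-- `σ ∈ Γ_F` as a `ℚ_p`-algebra automorphism of `B_st(F)`. [folklore] -/
def galBstAlgHom (σ : absoluteGaloisGroup F) : (Bmax F p)[X] →ₐ[ℚ_[p]] (Bmax F p)[X] :=
  ⟨galBst σ, galBst_algebraMap σ⟩

variable (F p) in
/-- `φ` as a `ℚ_p`-algebra endomorphism of `B_st(F)`. [folklore] -/
def frobBstAlgHom : (Bmax F p)[X] →ₐ[ℚ_[p]] (Bmax F p)[X] := ⟨frobBst F p, frobBst_algebraMap⟩

/-- `φ` commutes with the action, `ℚ_p`-algebra form. [folklore] -/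
theorem galBstAlgHom_comp_frobBstAlgHom (σ : absoluteGaloisGroup F) :
    (galBstAlgHom (F := F) (p := p) σ).comp (frobBstAlgHom F p) = (frobBstAlgHom F p).comp (galBstAlgHom σ) :=
  AlgHom.ext fun x => RingHom.congr_fun (galBst_comp_frobBst (F := F) (p := p) σ) x

/-- `N` commutes with the action, linear form. [folklore] -/
theorem galBstAlgHom_comp_NBst (σ : absoluteGaloisGroup F) :
    (galBstAlgHom (F := F) (p := p) σ).toLinearMap ∘ₗ NBst F p = NBst F p ∘ₗ (galBstAlgHom σ).toLinearMap :=
  LinearMap.ext fun P => (NBst_galBst σ P).symm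

/-! ### §3 `D_st` of a local framed representation, with `φ_D` and `N_D` -/

/-- **`D_st(ρ_v) := (ℚ̄_p^m ⊗_{ℚ_p} B_st(F))^{Γ_F}`** for a framed `ρ_v : Γ_F → GL_m(ℚ̄_p)`, over the
CONSTRUCTED `B_st(F) = B_max(F)[X]`. [cite: FontaineAsterisque223III, Exp. III §1.3] -/
def Dst {m : ℕ} (ρv : FramedRep (absoluteGaloisGroup F) (PadicAlgCl p) m) :
    Submodule (PadicAlgCl p) ((Fin m → PadicAlgCl p) ⊗[ℚ_[p]] (Bmax F p)[X]) :=
  invariants ρv (galBstAlgHom (F := F) (p := p))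

/-- **`φ` on `D_st(ρ_v)`** (`ℚ̄_p`-linear). [cite: FontaineAsterisque223III, Exp. III §1.3] -/
def phiDst {m : ℕ} (ρv : FramedRep (absoluteGaloisGroup F) (PadicAlgCl p) m) :
    Dst ρv →ₗ[PadicAlgCl p] Dst ρv :=
  phiD ρv (galBstAlgHom (F := F) (p := p)) (frobBstAlgHom F p) galBstAlgHom_comp_frobBstAlgHom

/-- **`N` on `D_st(ρ_v)`** (`ℚ̄_p`-linear). [cite: FontaineAsterisque223III, Exp. III §1.3] -/
def NDst {m : ℕ} (ρv : FramedRep (absoluteGaloisGroup F) (PadicAlgCl p) m) :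
    Dst ρv →ₗ[PadicAlgCl p] Dst ρv :=
  endD ρv (galBstAlgHom (F := F) (p := p)) (NBst F p) galBstAlgHom_comp_NBst

/-- **`N_D φ_D = p φ_D N_D` on `D_st(ρ_v)`.** [cite: FontaineAsterisque223III, Exp. III §1.3] -/
theorem NDst_phiDst {m : ℕ} (ρv : FramedRep (absoluteGaloisGroup F) (PadicAlgCl p) m) (x : Dst ρv) :
    NDst ρv (phiDst ρv x) = p • phiDst ρv (NDst ρv x) := by
  refine Subtype.ext ?_
  change endTensor (NBst F p) (phiTensor (frobBstAlgHom F p) (x : (Fin m → PadicAlgCl p) ⊗[ℚ_[p]] (Bmax F p)[X])) =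
    p • phiTensor (frobBstAlgHom F p) (endTensor (NBst F p) (x : (Fin m → PadicAlgCl p) ⊗[ℚ_[p]] (Bmax F p)[X]))
  induction (x : (Fin m → PadicAlgCl p) ⊗[ℚ_[p]] (Bmax F p)[X]) using TensorProduct.induction_on with
  | zero => simp
  | tmul v b =>
    simp only [endTensor, phiTensor, TensorProduct.AlgebraTensorModule.map_tmul, LinearMap.id_apply,
      AlgHom.toLinearMap_apply]
    change v ⊗ₜ NBst F p (frobBst F p b) = p • (v ⊗ₜ frobBst F p (NBst F p b))
    rw [NBst_frobBst, map_natCast C, ← nsmul_eq_mul]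
    exact map_nsmul (TensorProduct.mk ℚ_[p] (Fin m → PadicAlgCl p) (Bmax F p)[X] v) p _
  | add x y hx hy => simp only [map_add, hx, hy, smul_add]

end Bst

end D2St

end Summit.Langlands.Langlands.Theorems

end
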